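import Mathlib
import HarnessLib
import Literature.Analysis.FluidPDE.SuitableWeak
import Literature.Analysis.FluidPDE.SelfSimilar
import Literature.Analysis.FluidPDE.LocalTypeI
import Literature.Analysis.FluidPDE.SpaceTimeRescaling
import Literature.Analysis.FluidPDE.LocalTypeIScaling
import Literature.Analysis.FluidPDE.LocalTypeICongr
import Literature.Analysis.FluidPDE.LocalTypeIReverseZoom
import Literature.Analysis.FluidPDE.SlabTypeICompactness
import Literature.Analysis.FluidPDE.TypeIRateOseenMildRepresentative
import Summits.NavierStokesRegularity.NavierStokesRegularity.Theorems.RellichScarApexLocalisationSpherePersistence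
import Summits.NavierStokesRegularity.NavierStokesRegularity.Theorems.RellichScarApexLocalisationParentChild

/-!
# Class blow-up persistence (line activity-genealogy-fission, crux ApexLocalisation,
# stub `stub_classBlowupPersistence`)

Let `(u_k, p_k, G_k)` be a SEQUENCE of continuous rate-Type-I suitable weak solutions on the
backward slab `𝕊 = (-∞, 0) × ℝ³` with common data `(C, I)`: weak gradient `G_k`, Albritton–Barker
quantity `𝐈 ≤ I < ⊤`, rate `‖u_k(t,x)‖ ≤ C/√(−t)`, continuous on the open slab.  Let `λ_k > 0`,
`x_k ∈ ℝ³`, `t_k < 0` with `t_k → 0` be such that the Navier–Stokes images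
`w_k(t, x) = λ_k u_k(λ_k² t, x_k + λ_k x) = (λ_k • stPull (λ_k²) λ_k 0 x_k u_k) t x`
blow up at their own origin column: `‖w_k(t_k, 0)‖ = λ_k ‖u_k(λ_k² t_k, x_k)‖ → ∞`.  Then
(`stub_classBlowupPersistence`) along a subsequence the `w_k` converge in `L³(Q(0, R))` for every
`R > 0` to a CONTINUOUS rate-Type-I suitable weak slab profile `(v, q, H)` with `𝐈 ≤ 4 I` which is
singular at the space–time origin.

This is the engine step E of the line; the one-profile case `u_k = u` is `stub_spherePersistence`
(file `RellichScarApexLocalisationSpherePersistence.lean`), whose proof is followed verbatim: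

1. the images `(w_k, λ_k² p_k∘Φ_k, λ_k² G_k∘Φ_k)` keep the class data `(C, I)` and continuity
   (`image_classData`);
2. the ENGINE `slab_typeI_compactness` (Albritton–Barker 2019, Lemma 2.2 + Prop. 2.3 on the slab)
   extracts `σ` and a limit `(v₀, q, H)` with `𝐈 ≤ 4 I` and `w_{σ j} → v₀` in `L³(Q(0, R))`;
3. persistence: `‖w_{σ j}‖_{L^∞(Q(0,R))} ≥ ‖w_{σ j}(t_{σ j}, 0)‖ → ∞`
   (`tendsto_eLpNorm_top_of_column_blowup`), so the ENGINE makes the origin a backward singular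
   point of `v₀`;
4. the rate passes to `v₀` a.e. (`ae_rate_of_tendsto_eLpNorm`), `exists_repr_hasTypeITimeDecay`
   gives a representative with the POINTWISE rate and `exists_oseenMild_repr_of_typeIBound_lt_top`
   a CONTINUOUS one keeping the rate; the class data, the singular origin and the `L³_loc`
   convergence are transferred along the a.e. equalities (`classData_congr_ae`).

## References

* D. Albritton, T. Barker, *On local Type I singularities of the Navier–Stokes equations and
  Liouville theorems*, J. Math. Fluid Mech. 21 (2019) = arXiv:1811.00502, Lemma 2.2, Prop. 2.3,
  §3. [AlbrittonBarker2019]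
-/

set_option linter.dupNamespace false

namespace Summit.NavierStokesRegularity.NavierStokesRegularity.Theorems.RellichScarApexLocalisation

open MeasureTheory Set Function Metric Filter Topology TopologicalSpace
open scoped ENNReal NNReal
open Literature.Analysis Literature.Analysis.FluidPDE

/-! ### The stub -/

/-- **E, CLASS BLOW-UP PERSISTENCE** (Albritton–Barker 2019 Lemma 2.2 + Prop. 2.3 on the slab = the
tree's `slab_typeI_compactness`, applied to Navier–Stokes images of a SEQUENCE of profiles; the
one-profile case is `stub_spherePersistence`): let `(u_k,p_k,G_k)` be continuous rate-Type-I suitable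
weak slab profiles with `𝐈 ≤ I < ⊤` and the same rate constant `C`, and let `λ_k > 0`, `x_k`,
`t_k < 0`, `t_k → 0` be such that the images `w_k(t,x) = λ_k u_k(λ_k² t, x_k + λ_k x)` blow up at
their own origin column: `λ_k ‖u_k(λ_k² t_k, x_k)‖ → ∞`. Then along a subsequence the `w_k` converge
in `L³(Q(0,R))` for every `R > 0` to a continuous rate-Type-I slab profile `(v,q,H)` with `𝐈 ≤ 4I`
which is singular at the space–time origin.
[cite: AlbrittonBarker2019, Lemma 2.2, Prop. 2.3 and §3] -/
theorem stub_classBlowupPersistence :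
    ∀ (C : ℝ) (I : ℝ≥0∞) (uk : ℕ → ℝ → (EuclideanSpace ℝ (Fin 3)) → (EuclideanSpace ℝ (Fin 3)))
      (pk : ℕ → ℝ → (EuclideanSpace ℝ (Fin 3)) → ℝ)
      (Gk : ℕ → ℝ → (EuclideanSpace ℝ (Fin 3)) →
        (EuclideanSpace ℝ (Fin 3)) →L[ℝ] (EuclideanSpace ℝ (Fin 3)))
      (lk : ℕ → ℝ) (xk : ℕ → (EuclideanSpace ℝ (Fin 3))) (tk : ℕ → ℝ),
      I < ⊤ →
      (∀ k, IsSuitableWeakSolutionOn (slab (EuclideanSpace ℝ (Fin 3)) (Iio 0) isOpen_Iio) 1 0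
        (uk k) (pk k)) →
      (∀ k, HasWeakSpatialGradientOn (slab (EuclideanSpace ℝ (Fin 3)) (Iio 0) isOpen_Iio)
        (uk k) (Gk k)) →
      (∀ k, typeIBound (Iio (0 : ℝ) ×ˢ univ) (uk k) (pk k) (Gk k) ≤ I) →
      (∀ k, HasTypeITimeDecay C (uk k)) →
      (∀ k, ContinuousOn (uncurry (uk k)) (Iio (0 : ℝ) ×ˢ univ)) →
      (∀ k, 0 < lk k) → (∀ k, tk k < 0) → Tendsto tk atTop (𝓝 0) →
      Tendsto (fun k => lk k * ‖uk k (lk k ^ 2 * tk k) (xk k)‖) atTop atTop →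
      ∃ (σ : ℕ → ℕ) (v : ℝ → (EuclideanSpace ℝ (Fin 3)) → (EuclideanSpace ℝ (Fin 3)))
        (q : ℝ → (EuclideanSpace ℝ (Fin 3)) → ℝ)
        (H : ℝ → (EuclideanSpace ℝ (Fin 3)) →
          (EuclideanSpace ℝ (Fin 3)) →L[ℝ] (EuclideanSpace ℝ (Fin 3))),
        StrictMono σ ∧
        IsSuitableWeakSolutionOn (slab (EuclideanSpace ℝ (Fin 3)) (Iio 0) isOpen_Iio) 1 0 v q ∧
        HasWeakSpatialGradientOn (slab (EuclideanSpace ℝ (Fin 3)) (Iio 0) isOpen_Iio) v H ∧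
        typeIBound (Iio (0 : ℝ) ×ˢ univ) v q H ≤ 4 * I ∧
        HasTypeITimeDecay C v ∧
        ContinuousOn (uncurry v) (Iio (0 : ℝ) ×ˢ univ) ∧
        IsBackwardSingularPoint v 0 ∧
        ∀ R : ℝ, 0 < R → Tendsto (fun j => eLpNorm
          (uncurry (lk (σ j) • stPull (lk (σ j) ^ 2) (lk (σ j)) 0 (xk (σ j)) (uk (σ j))) -
            uncurry v) 3
          (volume.restrict (parabolicCylinder R (0 : ℝ × (EuclideanSpace ℝ (Fin 3))))))
            atTop (𝓝 0) := by
  intro C I uk pk Gk lk xk tk hI hsw hwg hIle hC hcont hlk htk htk0 hblow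
  -- ## Step 0: `0 ≤ C` (the rate of `uk 0` at `(t, x) = (-1, 0)`)
  have hC0 : 0 ≤ C := by
    have h := hC 0 (-1) (by norm_num) 0
    rw [neg_neg, Real.sqrt_one, div_one] at h
    exact (norm_nonneg _).trans h
  -- ## Step 1: the images and their class data
  set w : ℕ → ℝ → (EuclideanSpace ℝ (Fin 3)) → (EuclideanSpace ℝ (Fin 3)) :=
    fun k => lk k • stPull (lk k ^ 2) (lk k) 0 (xk k) (uk k) with hw
  set qk' : ℕ → ℝ → (EuclideanSpace ℝ (Fin 3)) → ℝ :=
    fun k => lk k ^ 2 • stPull (lk k ^ 2) (lk k) 0 (xk k) (pk k) with hqk'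
  set Gk' : ℕ → ℝ → (EuclideanSpace ℝ (Fin 3)) →
      (EuclideanSpace ℝ (Fin 3)) →L[ℝ] (EuclideanSpace ℝ (Fin 3)) :=
    fun k => lk k ^ 2 • stPull (lk k ^ 2) (lk k) 0 (xk k) (Gk k) with hGk'
  have hcd := fun k => image_classData (hsw k) (hwg k) (hIle k) (hC k) (hcont k) (hlk k) (xk k)
  have hswk : ∀ k, IsSuitableWeakSolutionOn (slab (EuclideanSpace ℝ (Fin 3)) (Iio 0) isOpen_Iio)
      1 0 (w k) (qk' k) := fun k => (hcd k).1
  have hwgk : ∀ k, HasWeakSpatialGradientOn (slab (EuclideanSpace ℝ (Fin 3)) (Iio 0) isOpen_Iio)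
      (w k) (Gk' k) := fun k => (hcd k).2.1
  have hIk : ∀ k, typeIBound (Iio (0 : ℝ) ×ˢ univ) (w k) (qk' k) (Gk' k) ≤ I :=
    fun k => (hcd k).2.2.1
  have hwC : ∀ k, HasTypeITimeDecay C (w k) := fun k => (hcd k).2.2.2.1
  have hwcont : ∀ k, ContinuousOn (uncurry (w k)) (Iio (0 : ℝ) ×ˢ univ) :=
    fun k => (hcd k).2.2.2.2
  have hval : ∀ k, ‖w k (tk k) 0‖ = lk k * ‖uk k (lk k ^ 2 * tk k) (xk k)‖ := fun k => by
    simp only [hw, smul_stPull_apply, smul_zero, add_zero, zero_add, norm_smul,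
      Real.norm_of_nonneg (hlk k).le]
  -- ## Step 2: the ENGINE
  obtain ⟨v₀, q, H, σ, hσ, hsw₀, hwg₀, hI₀, hconv₀, hpers₀⟩ :=
    slab_typeI_compactness I w qk' Gk' hI hswk hwgk hIk
  -- ## Step 3: persistence — the images blow up in `L^∞(Q(0, R))` for every `R > 0`
  have hsing₀ : IsBackwardSingularPoint v₀ 0 := by
    refine hpers₀ fun R hR => Tendsto.limsup_eq ?_
    refine tendsto_eLpNorm_top_of_column_blowup (W := fun j => w (σ j)) (s := fun j => tk (σ j))
      (fun j => hwcont (σ j)) (fun j => htk (σ j)) (htk0.comp hσ.tendsto_atTop) ?_ hR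
    have h := hblow.comp hσ.tendsto_atTop
    refine h.congr fun j => ?_
    simp only [Function.comp_apply, hval]
  -- ## Step 4: the rate a.e. for the limit, and a representative with the pointwise rate
  have hrate₀ : ∀ᵐ z ∂(volume.restrict (Iio (0 : ℝ) ×ˢ (univ : Set (EuclideanSpace ℝ (Fin 3))))),
      ‖v₀ z.1 z.2‖ ≤ C / Real.sqrt (-z.1) :=
    ae_rate_of_tendsto_eLpNorm (W := fun j => w (σ j))
      (fun j => (hwgk (σ j)).locallyIntegrableOn.aestronglyMeasurable)
      hwg₀.locallyIntegrableOn.aestronglyMeasurable (fun j => hwC (σ j))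
      (fun n => hconv₀ ((n : ℝ) + 1) (by positivity))
  obtain ⟨v₁, hae₁, hC₁⟩ := exists_repr_hasTypeITimeDecay hC0 hrate₀
  obtain ⟨hsw₁, hwg₁, hI₁, hsing₁, hconv₁⟩ := classData_congr_ae hae₁ hsw₀ hwg₀ hI₀ hsing₀ hconv₀
  -- ## Step 5: the continuous (Oseen-mild) representative, keeping the rate
  have hI₁top : typeIBound (Iio (0 : ℝ) ×ˢ univ) v₁ q H < ⊤ :=
    lt_of_le_of_lt hI₁ (ENNReal.mul_lt_top (by simp) hI)
  obtain ⟨v, hae₂, hvcont, -, -, hvC⟩ := exists_oseenMild_repr_of_typeIBound_lt_top hsw₁ hC₁ hI₁top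
  obtain ⟨hswv, hwgv, hIv, hsingv, hconvv⟩ := classData_congr_ae hae₂ hsw₁ hwg₁ hI₁ hsing₁ hconv₁
  exact ⟨σ, v, q, H, hσ, hswv, hwgv, hIv, hvC, hvcont, hsingv, fun R hR => hconvv R hR⟩

end Summit.NavierStokesRegularity.NavierStokesRegularity.Theorems.RellichScarApexLocalisation
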